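import Mathlib
import Literature.MathematicalPhysics.QuantumFieldTheory.Balaban1983to89.T4CubeShellProfile


/-!
# Cube-shell conditioning VIII: the RELATIVE covariance profile `κ_P` of a conditioning-closed sub-class `P ⊆ 𝔐`,
the relative recursion `κ_P(M) ≤ λ⁻¹ · N(m) · 2R² · κ_P(m)²` (`M > 2m + 3r`), the barrier modulo one RELATIVE seed,
and the in-situ read-out for ONE action through its conditioning orbit

Landing edition «CubeShell VIII» of the ideation cell `ym-nodeO-ideate` (seat P1, lens «inside Bałaban»; memo
`memos/ROUTE-P1.md` §0y.40, companion 44 `memos/ROUTE-P1-SketchCubeShellVIII.lean`), over the landed module VII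
`T4CubeShellProfile` of this directory (seat P8; modules I–VII).  It answers the consumer caveat (O1′) recorded in the cell's
close-out sheet `memos/landing/T4CubeShell-SOCKETS.md`: module VII's profile `Spec.kappa m` is a supremum over the WHOLE
class `𝔐 = Spec.InClass`, so the seed `hseed` of `Spec.kappa_barrier` is CLASS-WIDE — an estimate proved for ONE action
(«in situ») does not inhabit it unless it is uniform over the class.  Sorry-free; no `axiom`; no `instance`; no notation;
carrier `Fin n → ℝ`, window `[-S,S]ⁿ`, the windowed Gibbs functionals `cubeCov ∕ shellCov` and the regularised conditional
potential `condPot` of modules I ∕ IV, the spec `Spec`, the class `Spec.InClass`, admissible triples `Spec.Adm`, the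
canonical split `fLo ∕ fHi`, the swap `lswap`, one-sided data `Spec.SideData` and the refinement labelling `Spec.rlab` of
module VII throughout — all BY NAME, nothing restated.

WHAT IS TYPED HERE (the same three printed ingredients as module VII — Brascamp–Lieb [BrascampLieb1976, Thm 4.1], the
DLR ∕ specification structure of finite-range Gibbs measures [FriedliVelenik2017, Lemma 6.7 (6.7)–(6.10), §6.10.1 (6.110)],
the Cauchy–Schwarz doubling of module V — arranged RELATIVE TO A SUB-CLASS):
* §1 for an arbitrary predicate `P` on potentials, the RELATIVE PROFILE `kappaP 𝔖 P m` = the supremum of `|cubeCov f S F H|`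
  over the admissible triples at separation `m` WITH `P f` (`0` adjoined): `0 ≤ κ_P ≤ κ ≤ λ⁻¹`, monotone in `P`, antitone
  in `m`, and `κ_⊤ = κ_𝔐 = κ` (module VII is the case `P = ⊤`);
* §2 CONDITIONING-CLOSED predicates `CondClosed 𝔖 P`: along every WIDE labelling and every boundary field IN THE WINDOW,
  both regularised conditional children of an `f ∈ 𝔐` with `P f` — `condPot lab λ (fLo lab f) x` and
  `condPot (lswap lab) λ (fHi lab f) x` — satisfy `P` again; `⊤` and `𝔐` are closed (the latter IS module VII's
  `inClass_condPot` + `sideData_lo ∕ _hi`), closedness is stable under conjunction, and every action `f₀` has a least closed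
  predicate containing it, its CONDITIONING ORBIT `Orbit 𝔖 f₀` (defined impredicatively; closed by construction);
  the one-sided recursion bound of module VII RELATIVE to `P` (`side_boundP`: the shell-indexed conditional covariances
  are `≤ C · κ_P(m)` as soon as the conditional children satisfy `P`);
* §3 THE RELATIVE STEP `kappaP_step : CondClosed 𝔖 P → 2m + 3r < M → κ_P(M) ≤ λ⁻¹ · (a · G(m + 2r)) · 2R² · κ_P(m)²`
  — module VII's `kappa_step` with the class replaced by `P`; the proof is VII's, the closure hypothesis feeding `P` to
  the children;
* §4 THE RELATIVE BARRIER `kappaP_barrier ∕ kappaP_barrier_of_le`: along `s_{j+1} = 2 s_j + 3r + 1`, under geometric shell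
  growth, ONE RELATIVE SEED `c A q κ_P(s_0) ≤ ρ` gives `κ_P(s_j) ≤ ρ^{2^j} ∕ (c A q^{j+1})` (`c = Spec.cst = 2R²∕λ`);
  `kappaP_seed_of_forall` spells the seed out as a pointwise bound over `P`;
* §5 THE IN-SITU READ-OUT: for ONE action `f₀ ∈ 𝔐`, a seed uniform over ITS CONDITIONING ORBIT (equivalently: over any
  closed `P ∋ f₀`) bounds `|cubeCov f₀ S F H|` for every admissible pair at separation `≥ s_j` by `ρ^{2^j} ∕ (c A q^{j+1})`
  (`abs_cubeCov_le_of_closed_seed`, `abs_cubeCov_le_of_orbit_seed`).  This is the typed form of the printed notion: the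
  strong-mixing profile `SMT(V, n, α)` of [Martinelli1999, §2.4 p.103, Def. 2.6] is a supremum over the BOUNDARY CONDITIONS
  `τ` of ONE interaction (`sup_τ |μ_V^τ(f,g)|`), not over a class of interactions; for unbounded continuous spins the
  boundary condition enters the conditional potential, whence the orbit;
* §6 A CONCRETE CLOSED PERTURBATIVE CLASS: `RowOsc ε f` (every Hessian row `∇∂_k f` varies by at most `ε` in `ℓ²` over
  the space; `ε = 0` = constant Hessian) and `NearGauss 𝔖 ε = 𝔐 ∩ RowOsc ε`; `rowOsc_condPot` (along one-sided data the
  regularised conditional potential inherits the row oscillation: inside rows are MASKED rows of `f` at the merged point,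
  the others are the constant `λ e_k`) and `condClosed_nearGauss : CondClosed 𝔖 (NearGauss 𝔖 ε)` (PROVED); the
  `λ`-Gaussian inhabits `𝔐_0 ⊆ 𝔐_ε`; `abs_cubeCov_le_of_nearGauss_seed` = §5 for this class.
WHAT THIS FILE DOES NOT CLAIM.  (i) No seed is proved here — relative or not, it is a HYPOTHESIS ((a) alone cannot supply
it since `R ≥ λ`), in particular the seed over `𝔐_ε` of §6 is NOT proved; (ii) the closed predicates exhibited are `⊤`,
`𝔐`, conjunctions, orbits (closed by definition) and the near-Gaussian classes `𝔐_ε` of §6 — it is NOT shown that any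
effective action of a renormalisation programme (extended off the window) lies in some `𝔐_ε`, and the bound `RowOsc` is
GLOBAL (window caveat); (iii) as in module VII, exponential decay of covariances for
uniformly convex finite-range potentials on the FULL space is KNOWN IN PRINT by the Helffer–Sjöstrand ∕ Witten-Laplacian
method [HelfferSjostrand1994], [Ledoux2001, Prop. 6.2 p.190] — §3–§4 are a typed alternative route with the seed explicit;
(iv) nothing here is an estimate on any density of Bałaban's renormalisation programme, nor a statement about
[Balaban1987RG1] Thm 2 ∕ (0.31), nor about the cell's target (an inhabitant of `B13TermWalkDataOneTorus.ExistsUniformAcrossSmall`):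
the model is the WINDOWED cube model with a GLOBAL Hessian bound and FINITE range.  Proofs ours; cite tags name the printed
sources of the ingredients ∕ the printed analogue.
-/

set_option autoImplicit false
namespace Literature.MathematicalPhysics.QuantumFieldTheory.Balaban1983to89.T4CubeShellProfileP

open MeasureTheory Set Matrix
open Literature.MathematicalPhysics.QuantumFieldTheory.Balaban1983to89.T4CubeShellConditional
open Literature.MathematicalPhysics.QuantumFieldTheory.Balaban1983to89.T4CubeShellDoubling
open Literature.MathematicalPhysics.QuantumFieldTheory.Balaban1983to89.T4CubePoincare
open Literature.MathematicalPhysics.QuantumFieldTheory.Balaban1983to89.T4CubeShellBlocks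
open Literature.MathematicalPhysics.QuantumFieldTheory.Balaban1983to89.T4CubeShellProfile
open Literature.Probability.Distributions

variable {n : ℕ}

/-! ## §1 The relative profile `κ_P` of a sub-class `P` -/

section ProfileP

variable (𝔖 : Spec n) (P : ((Fin n → ℝ) → ℝ) → Prop)

/-- The set of covariance values realised at separation `m` by admissible triples whose potential satisfies `P`
(with `0` adjoined). [folklore] [cite: Martinelli1999, §2.4 p.103 (Def. 2.6)] -/
def profileSetP (m : ℕ) : Set ℝ :=
  {t | t = 0 ∨ ∃ f F H : (Fin n → ℝ) → ℝ, 𝔖.Adm m f F H ∧ P f ∧ t = |cubeCov f 𝔖.S F H|}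

/-- THE RELATIVE COVARIANCE PROFILE `κ_P(m) = sup {|Cov_K(F,H)| : (f, F, H) admissible at separation m, P f}`.
[folklore] [cite: Martinelli1999, §2.4 p.103 (Def. 2.6)] -/
noncomputable def kappaP (m : ℕ) : ℝ := sSup (profileSetP 𝔖 P m)

/-- `0` is adjoined to the relative profile set. [cite: Martinelli1999, §2.4 p.103 (Def. 2.6)] -/
theorem zero_mem_profileSetP (m : ℕ) : (0 : ℝ) ∈ profileSetP 𝔖 P m := Or.inl rfl

/-- The relative profile set is nonempty. [cite: Martinelli1999, §2.4 p.103 (Def. 2.6)] -/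
theorem profileSetP_nonempty (m : ℕ) : (profileSetP 𝔖 P m).Nonempty := ⟨0, zero_mem_profileSetP 𝔖 P m⟩

/-- The relative profile set is contained in module VII's profile set. [cite: Martinelli1999, §2.4 p.103 (Def. 2.6)] -/
theorem profileSetP_subset (m : ℕ) : profileSetP 𝔖 P m ⊆ 𝔖.profileSet m := by
  rintro t (rfl | ⟨f, F, H, hA, -, rfl⟩)
  · exact 𝔖.zero_mem_profileSet m
  · exact Or.inr ⟨f, F, H, hA, rfl⟩

/-- The relative profile set is bounded above (by `λ⁻¹`, Brascamp–Lieb via module VII). [cite: BrascampLieb1976, Thm 4.1] -/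
theorem profileSetP_bddAbove (m : ℕ) : BddAbove (profileSetP 𝔖 P m) :=
  (𝔖.profileSet_bddAbove m).mono (profileSetP_subset 𝔖 P m)

/-- `0 ≤ κ_P(m)`. [cite: Martinelli1999, §2.4 p.103 (Def. 2.6)] -/
theorem kappaP_nonneg (m : ℕ) : 0 ≤ kappaP 𝔖 P m :=
  le_csSup (profileSetP_bddAbove 𝔖 P m) (zero_mem_profileSetP 𝔖 P m)

/-- **Every admissible covariance with `P f` is bounded by the relative profile.**
[cite: Martinelli1999, §2.4 p.103 (Def. 2.6)] -/
theorem abs_cubeCov_le_kappaP {m : ℕ} {f F H : (Fin n → ℝ) → ℝ} (h : 𝔖.Adm m f F H) (hP : P f) :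
    |cubeCov f 𝔖.S F H| ≤ kappaP 𝔖 P m :=
  le_csSup (profileSetP_bddAbove 𝔖 P m) (Or.inr ⟨f, F, H, h, hP, rfl⟩)

/-- **The relative profile is the LEAST such bound.** [cite: Martinelli1999, §2.4 p.103 (Def. 2.6)] -/
theorem kappaP_le_of_forall {m : ℕ} {b : ℝ} (hb : 0 ≤ b)
    (h : ∀ f F H : (Fin n → ℝ) → ℝ, 𝔖.Adm m f F H → P f → |cubeCov f 𝔖.S F H| ≤ b) : kappaP 𝔖 P m ≤ b := by
  refine csSup_le (profileSetP_nonempty 𝔖 P m) ?_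
  rintro t (rfl | ⟨f, F, H, hA, hP, rfl⟩)
  · exact hb
  · exact h f F H hA hP

/-- `κ_P ≤ κ`: a sub-class profile is below module VII's class-wide profile. [cite: Martinelli1999, §2.4 p.103 (Def. 2.6)] -/
theorem kappaP_le_kappa (m : ℕ) : kappaP 𝔖 P m ≤ 𝔖.kappa m :=
  csSup_le_csSup (𝔖.profileSet_bddAbove m) (profileSetP_nonempty 𝔖 P m) (profileSetP_subset 𝔖 P m)

/-- `κ_P(m) ≤ λ⁻¹` (Brascamp–Lieb; no decay). [cite: BrascampLieb1976, Thm 4.1] -/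
theorem kappaP_le_inv_lam (m : ℕ) : kappaP 𝔖 P m ≤ 𝔖.lam⁻¹ :=
  (kappaP_le_kappa 𝔖 P m).trans (𝔖.kappa_le_inv_lam m)

/-- The relative profile is monotone in the predicate. [cite: Martinelli1999, §2.4 p.103 (Def. 2.6)] -/
theorem kappaP_mono {Q : ((Fin n → ℝ) → ℝ) → Prop} (hPQ : ∀ f, P f → Q f) (m : ℕ) :
    kappaP 𝔖 P m ≤ kappaP 𝔖 Q m :=
  kappaP_le_of_forall 𝔖 P (kappaP_nonneg 𝔖 Q m) fun f _ _ hA hP => abs_cubeCov_le_kappaP 𝔖 Q hA (hPQ f hP)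

/-- **The relative profile is non-increasing in the separation.** [cite: Martinelli1999, §2.4 p.103 (Def. 2.6)] -/
theorem kappaP_antitone : Antitone (kappaP 𝔖 P) := fun m _ hmm' =>
  kappaP_le_of_forall 𝔖 P (kappaP_nonneg 𝔖 P m) fun _ _ _ h hP =>
    abs_cubeCov_le_kappaP 𝔖 P (Spec.Adm.anti 𝔖 hmm' h) hP

/-- Module VII is the case `P = ⊤`: `κ_⊤ = κ`. [cite: Martinelli1999, §2.4 p.103 (Def. 2.6)] -/
theorem kappaP_true (m : ℕ) : kappaP 𝔖 (fun _ => True) m = 𝔖.kappa m :=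
  le_antisymm (kappaP_le_kappa 𝔖 _ m)
    (𝔖.kappa_le_of_forall (kappaP_nonneg 𝔖 _ m) fun _ _ _ hA => abs_cubeCov_le_kappaP 𝔖 _ hA trivial)

/-- … and also the case `P = 𝔐` (admissibility already contains `f ∈ 𝔐`): `κ_𝔐 = κ`. [cite: Martinelli1999, §2.4 p.103 (Def. 2.6)] -/
theorem kappaP_inClass (m : ℕ) : kappaP 𝔖 𝔖.InClass m = 𝔖.kappa m :=
  le_antisymm (kappaP_le_kappa 𝔖 _ m)
    (𝔖.kappa_le_of_forall (kappaP_nonneg 𝔖 _ m) fun _ _ _ hA => abs_cubeCov_le_kappaP 𝔖 _ hA hA.1)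

end ProfileP

/-! ## §2 Conditioning-closed predicates, the conditioning orbit of one action, and the relative one-sided bound -/

section Closed

variable (𝔖 : Spec n)

/-- `P` is CONDITIONING-CLOSED for the spec `𝔖`: along every wide labelling `lab` and for every boundary field `x` in the
window, both regularised conditional children of an `f ∈ 𝔐` with `P f` — the inside child `condPot lab λ (fLo lab f) x`
and the outside child `condPot (lswap lab) λ (fHi lab f) x` — satisfy `P`.  (The boundary field is restricted to the
window `[-S,S]ⁿ`: that is all the recursion uses, and it is what an in-situ small-field class needs.)
[folklore] [cite: FriedliVelenik2017, Lemma 6.7 (6.7)–(6.10); FriedliVelenik2017, §6.10.1 (6.110); Martinelli1999, §2.4 p.103 (Def. 2.6)] -/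
def CondClosed (P : ((Fin n → ℝ) → ℝ) → Prop) : Prop :=
  ∀ ⦃lab : Fin n → Fin 3⦄, 𝔖.Wide lab → ∀ ⦃f : (Fin n → ℝ) → ℝ⦄, 𝔖.InClass f → P f →
    ∀ x ∈ cube n 𝔖.S, P (condPot lab 𝔖.lam (fLo lab f) x) ∧ P (condPot (lswap lab) 𝔖.lam (fHi lab f) x)

/-- `⊤` is conditioning-closed. [folklore] [cite: Martinelli1999, §2.4 p.103 (Def. 2.6)] -/
theorem condClosed_true : CondClosed 𝔖 (fun _ => True) := fun _ _ _ _ _ _ _ => ⟨trivial, trivial⟩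

/-- **The whole class `𝔐` is conditioning-closed** — this IS module VII's closure theorem `inClass_condPot` along the
canonical one-sided data `sideData_lo ∕ sideData_hi`. [cite: HornJohnson2013, Thm 4.3.28 (4.3.30); BrascampLieb1976, Thm 4.1; FriedliVelenik2017, Lemma 6.7 (6.7); FriedliVelenik2017, §6.10.1 (6.110)] -/
theorem condClosed_inClass : CondClosed 𝔖 𝔖.InClass := fun _ hw _ hf _ x _ =>
  ⟨𝔖.inClass_condPot (𝔖.sideData_lo hf hw) x, 𝔖.inClass_condPot (𝔖.sideData_hi hf hw) x⟩

/-- Conditioning-closedness is stable under conjunction. [folklore] [cite: FriedliVelenik2017, Lemma 6.7 (6.7)–(6.10)] -/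
theorem condClosed_and {P Q : ((Fin n → ℝ) → ℝ) → Prop} (hP : CondClosed 𝔖 P) (hQ : CondClosed 𝔖 Q) :
    CondClosed 𝔖 (fun f => P f ∧ Q f) := fun _ hw _ hf hPQ x hx =>
  ⟨⟨(hP hw hf hPQ.1 x hx).1, (hQ hw hf hPQ.2 x hx).1⟩, ⟨(hP hw hf hPQ.1 x hx).2, (hQ hw hf hPQ.2 x hx).2⟩⟩

/-- Intersecting with `𝔐` keeps a closed predicate closed (so one may always assume `P ⊆ 𝔐`). [folklore] [cite: FriedliVelenik2017, Lemma 6.7 (6.7)–(6.10)] -/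
theorem condClosed_and_inClass {P : ((Fin n → ℝ) → ℝ) → Prop} (hP : CondClosed 𝔖 P) :
    CondClosed 𝔖 (fun f => 𝔖.InClass f ∧ P f) :=
  condClosed_and 𝔖 (condClosed_inClass 𝔖) hP

/-- THE CONDITIONING ORBIT of one action `f₀`: the least conditioning-closed predicate containing `f₀` (the intersection of
all of them).  For a finite-range interaction this is the typed counterpart of «the same interaction with every boundary
condition» over which the printed strong-mixing profile takes its supremum.
[folklore] [cite: Martinelli1999, §2.4 p.103 (Def. 2.6); FriedliVelenik2017, Lemma 6.7 (6.7)–(6.10)] -/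
def Orbit (f₀ : (Fin n → ℝ) → ℝ) : ((Fin n → ℝ) → ℝ) → Prop :=
  fun f => ∀ P : ((Fin n → ℝ) → ℝ) → Prop, CondClosed 𝔖 P → P f₀ → P f

/-- `f₀` is in its own orbit. [folklore] [cite: Martinelli1999, §2.4 p.103 (Def. 2.6)] -/
theorem orbit_self (f₀ : (Fin n → ℝ) → ℝ) : Orbit 𝔖 f₀ f₀ := fun _ _ h => h

/-- The orbit is contained in every closed predicate containing `f₀`. [folklore] [cite: Martinelli1999, §2.4 p.103 (Def. 2.6)] -/
theorem orbit_le {P : ((Fin n → ℝ) → ℝ) → Prop} (hP : CondClosed 𝔖 P) {f₀ : (Fin n → ℝ) → ℝ} (h₀ : P f₀) :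
    ∀ f, Orbit 𝔖 f₀ f → P f := fun _ hf => hf P hP h₀

/-- **The orbit is conditioning-closed.** [folklore] [cite: FriedliVelenik2017, Lemma 6.7 (6.7)–(6.10)] -/
theorem condClosed_orbit (f₀ : (Fin n → ℝ) → ℝ) : CondClosed 𝔖 (Orbit 𝔖 f₀) := fun _ hw _ hf hO x hx =>
  ⟨fun P hP h₀ => (hP hw hf (hO P hP h₀) x hx).1, fun P hP h₀ => (hP hw hf (hO P hP h₀) x hx).2⟩

/-- The orbit of an `f₀ ∈ 𝔐` stays in `𝔐`. [cite: BrascampLieb1976, Thm 4.1; FriedliVelenik2017, Lemma 6.7 (6.7)] -/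
theorem orbit_inClass {f₀ : (Fin n → ℝ) → ℝ} (h₀ : 𝔖.InClass f₀) : ∀ f, Orbit 𝔖 f₀ f → 𝔖.InClass f :=
  orbit_le 𝔖 (condClosed_inClass 𝔖) h₀

/-- The orbit profile is the smallest relative profile seen by `f₀`: `κ_{Orbit f₀} ≤ κ_P` for every closed `P ∋ f₀`.
[cite: Martinelli1999, §2.4 p.103 (Def. 2.6)] -/
theorem kappaP_orbit_le {P : ((Fin n → ℝ) → ℝ) → Prop} (hP : CondClosed 𝔖 P) {f₀ : (Fin n → ℝ) → ℝ} (h₀ : P f₀)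
    (m : ℕ) : kappaP 𝔖 (Orbit 𝔖 f₀) m ≤ kappaP 𝔖 P m :=
  kappaP_mono 𝔖 (Orbit 𝔖 f₀) (orbit_le 𝔖 hP h₀) m

variable (P : ((Fin n → ℝ) → ℝ) → Prop)

/-- **THE RELATIVE ONE-SIDED RECURSION BOUND (PROVED)** — module VII's `side_bound` with the class-wide profile replaced by
`κ_P`: along one-sided data with row constant `C`, for an insert `F` supported in `A ⊆ inside` with `d(A, shell) > m + r`,
IF the conditional children `condPot lab λ f₁ x` (`x` in the window) satisfy `P`, then every shell-indexed conditional
covariance is `≤ C · κ_P(m)` — the child triple (`condPot lab λ f₁ x`, `F ∘ merge`, `C⁻¹·(∂_j f₁) ∘ merge`) is admissible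
at level `m` WITH `P` and the conditional covariance is its cube covariance (module IV `shellCov_grad_eq_cubeCov_condPot`).
The proof is module VII's, verbatim but for the last estimate.
[cite: BrascampLieb1976, Thm 4.1; FriedliVelenik2017, Lemma 6.7 (6.7); FriedliVelenik2017, §6.10.1 (6.110); Martinelli1999, §2.4 p.103 (Def. 2.6)] -/
theorem side_boundP {lab : Fin n → Fin 3} {f f₁ f₂ : (Fin n → ℝ) → ℝ} {C : ℝ} (hD : 𝔖.SideData lab f f₁ f₂ C)
    {m : ℕ} {F : (Fin n → ℝ) → ℝ} {A : Finset (Fin n)} (hF : 𝔖.Obs F A) (hA0 : ∀ i ∈ A, lab i = 0)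
    (hA1 : ∀ j, lab j = 1 → ∀ i ∈ A, m + 𝔖.r < 𝔖.d i j)
    (hcl : ∀ x ∈ cube n 𝔖.S, P (condPot lab 𝔖.lam f₁ x)) :
    ∀ x ∈ cube n 𝔖.S, ∀ j, lab j = 1 →
      |shellCov lab f₁ 𝔖.S F (fun y => coordGradient f₁ y j) x| ≤ C * kappaP 𝔖 P m := by
  intro x hx j hj
  obtain ⟨hFc, hF1, hFd, hAcard⟩ := hF
  have hC : C ≠ 0 := hD.C_pos.ne'
  have hm1 : ContDiff ℝ 1 (merge lab x) := contDiff_merge_right lab x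
  have hdj : ContDiff ℝ 1 (fun y => coordGradient f₁ y j) := contDiff_one_coordGradient hD.cd₁ j
  have hdjm : Differentiable ℝ (fun z => coordGradient f₁ (merge lab x z) j) :=
    (hdj.differentiable one_ne_zero).comp (hm1.differentiable one_ne_zero)
  -- the child inserts
  have hF' : 𝔖.Obs (fun z => F (merge lab x z)) A :=
    ⟨hFc.comp hm1, fun z => (gradSq_comp_merge_le lab (hFc.differentiable one_ne_zero) x z).trans (hF1 _),
      dependsOn_comp_merge_right lab x hFd, hAcard⟩
  have hG' : 𝔖.Obs (fun z => C⁻¹ * coordGradient f₁ (merge lab x z) j) (𝔖.ball 𝔖.r j) := by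
    refine ⟨contDiff_const.mul (hdj.comp hm1), fun z => ?_,
      dependsOn_const_mul (dependsOn_comp_merge_right lab x (hD.shell_dep j hj)) C⁻¹, 𝔖.card_ball_le_a j⟩
    rw [gradSq_const_mul hdjm C⁻¹ z]
    have h := (gradSq_comp_merge_le lab (Φ := fun y => coordGradient f₁ y j) (hdj.differentiable one_ne_zero)
      x z).trans (hD.shell_row j hj _)
    calc C⁻¹ ^ 2 * (coordGradient (fun z => coordGradient f₁ (merge lab x z) j) z
            ⬝ᵥ coordGradient (fun z => coordGradient f₁ (merge lab x z) j) z)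
        ≤ C⁻¹ ^ 2 * C ^ 2 := by gcongr
      _ = 1 := by field_simp
  -- separation at level m
  have hsep : ∀ i ∈ A, ∀ k ∈ 𝔖.ball 𝔖.r j, m < 𝔖.d i k := by
    intro i hi k hk
    have h1 := hA1 j hj i hi
    have h2 := 𝔖.mem_ball.mp hk
    have h3 := 𝔖.d_tri i k j
    omega
  have hAdm : 𝔖.Adm m (condPot lab 𝔖.lam f₁ x) (fun z => F (merge lab x z))
      (fun z => C⁻¹ * coordGradient f₁ (merge lab x z) j) :=
    ⟨𝔖.inClass_condPot hD x, A, 𝔖.ball 𝔖.r j, hF', hG', hsep⟩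
  have hκ := abs_cubeCov_le_kappaP 𝔖 P hAdm (hcl x hx)
  -- identification of the conditional covariance with the child's cube covariance, and rescaling
  have hFd2 : DependsOn F {i | lab i ≠ 2} := hFd.mono fun i hi => by
    have h := hA0 i (Finset.mem_coe.mp hi)
    show lab i ≠ 2
    rw [h]; decide
  rw [shellCov_grad_eq_cubeCov_condPot 𝔖.S_pos lab 𝔖.lam (hD.cd₁.of_le (by norm_num)) hFc.continuous hD.dep₁
    hFd2 x j]
  have e : (fun z => coordGradient f₁ (merge lab x z) j)
      = fun z => C * (C⁻¹ * coordGradient f₁ (merge lab x z) j) := by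
    funext z
    rw [← mul_assoc, mul_inv_cancel₀ hC, one_mul]
  rw [e, cubeCov_const_mul_right, abs_mul, abs_of_pos hD.C_pos]
  exact mul_le_mul_of_nonneg_left hκ hD.C_pos.le

end Closed

/-! ## §3 THE RELATIVE STEP `κ_P(M) ≤ λ⁻¹ · (a·G(m+2r)) · 2R² · κ_P(m)²` for `M > 2m + 3r` and closed `P` -/

section StepP

variable (𝔖 : Spec n) (P : ((Fin n → ℝ) → ℝ) → Prop)

/-- **THE RELATIVE STEP (PROVED): the doubling recursion of the relative profile of a conditioning-closed sub-class.**
For every closed `P` and `M > 2m + 3r`, `κ_P(M) ≤ λ⁻¹ · (a · G(m + 2r)) · 2R² · κ_P(m)²`.  Module VII's `kappa_step`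
verbatim, the closure hypothesis certifying that BOTH children of an admissible triple with `P f`, along the refinement
labelling `rlab (supp F) m` and its swap, satisfy `P` for every boundary field in the window, so that `side_boundP`
applies on both sides with `κ₁ = κ₂ = κ_P(m)`.
[cite: BrascampLieb1976, Thm 4.1; FriedliVelenik2017, Exercise 3.11 (3.26); GlimmJaffe1987, Cor. 4.3.4 (proof); Martinelli1999, §2.4 p.103 (Def. 2.6, Thm 2.7); MartinelliOlivieri1994] -/
theorem kappaP_step (hcl : CondClosed 𝔖 P) {m M : ℕ} (hM : 2 * m + 3 * 𝔖.r < M) :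
    kappaP 𝔖 P M ≤ 𝔖.lam⁻¹ * ((𝔖.a * 𝔖.growth (m + 2 * 𝔖.r) : ℕ) : ℝ) * (2 * 𝔖.R ^ 2) * kappaP 𝔖 P m ^ 2 := by
  have hlam := 𝔖.lam_pos
  have hκ := kappaP_nonneg 𝔖 P m
  refine kappaP_le_of_forall 𝔖 P (by positivity) fun f F H hAdm hPf => ?_
  obtain ⟨hfC, A, B, hF, hH, hsep⟩ := hAdm
  have hw : 𝔖.Wide (𝔖.rlab A m) := 𝔖.wide_rlab
  have hDlo := 𝔖.sideData_lo hfC hw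
  have hDhi := 𝔖.sideData_hi hfC hw
  -- closure: both children satisfy `P` for every boundary field in the window
  have hclo : ∀ x ∈ cube n 𝔖.S, P (condPot (𝔖.rlab A m) 𝔖.lam (fLo (𝔖.rlab A m) f) x) :=
    fun x hx => (hcl hw hfC hPf x hx).1
  have hchi : ∀ x ∈ cube n 𝔖.S, P (condPot (lswap (𝔖.rlab A m)) 𝔖.lam (fHi (𝔖.rlab A m) f) x) :=
    fun x hx => (hcl hw hfC hPf x hx).2
  -- the two one-sided bounds, relative to `P`
  have hβ := side_boundP 𝔖 P hDlo (m := m) hF (fun i hi => 𝔖.rlab_of_mem hi) (fun j hj => 𝔖.rlab_shell_far hj)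
    hclo
  have hγ' := side_boundP 𝔖 P hDhi (m := m) hH
    (fun k hk => (lswap_spec _ k).1.mpr (𝔖.rlab_of_sep hsep hM hk))
    (fun j hj => 𝔖.rlab_shell_far' hsep hM ((lswap_spec _ j).2.1.mp hj)) hchi
  have hγ : ∀ x ∈ cube n 𝔖.S, ∀ j, 𝔖.rlab A m j = 1 →
      |shellCov (𝔖.rlab A m) (fHi (𝔖.rlab A m) f) 𝔖.S H (fun y => coordGradient (fHi (𝔖.rlab A m) f) y j) x|
        ≤ 𝔖.R * kappaP 𝔖 P m := by
    intro x hx j hj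
    rw [← shellCov_lswap]
    exact hγ' x hx j ((lswap_spec _ j).2.1.mpr hj)
  -- the hypotheses of the doubling theorem
  have hB' : HessianBound (fLo (𝔖.rlab A m) f + fHi (𝔖.rlab A m) f) 𝔖.lam := by
    rw [fLo_add_fHi]; exact hfC.2.1
  have hFd : DependsOn F {i | 𝔖.rlab A m i = 0} :=
    hF.2.2.1.mono fun i hi => 𝔖.rlab_of_mem (Finset.mem_coe.mp hi)
  have hHd : DependsOn H {i | 𝔖.rlab A m i = 2} :=
    hH.2.2.1.mono fun k hk => 𝔖.rlab_of_sep hsep hM (Finset.mem_coe.mp hk)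
  have key := abs_cubeCov_le_doubling_profile 𝔖.S_pos 𝔖.lam_pos (𝔖.rlab A m) hDlo.cd₁ hDlo.cd₂ hB' hF.1 hH.1
    hDlo.dep₁ hFd hDlo.dep₂ hHd (κ₁ := kappaP 𝔖 P m) (κ₂ := kappaP 𝔖 P m) (C_F := 2 * 𝔖.R) (C_H := 𝔖.R) hκ hκ
    (by have := 𝔖.R_pos; positivity) 𝔖.R_pos.le hβ hγ
  rw [fLo_add_fHi] at key
  -- counting the shell
  have hN : (((Finset.univ.filter fun j => 𝔖.rlab A m j = 1).card : ℕ) : ℝ)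
      ≤ ((𝔖.a * 𝔖.growth (m + 2 * 𝔖.r) : ℕ) : ℝ) := by
    have h1 := 𝔖.card_shell_le (A := A) (m := m)
    have h2 : A.card * 𝔖.growth (m + 2 * 𝔖.r) ≤ 𝔖.a * 𝔖.growth (m + 2 * 𝔖.r) :=
      Nat.mul_le_mul_right _ hF.2.2.2
    exact_mod_cast h1.trans h2
  have hR := 𝔖.R_pos
  calc |cubeCov f 𝔖.S F H|
      ≤ 𝔖.lam⁻¹ * ((Finset.univ.filter fun j => 𝔖.rlab A m j = 1).card : ℝ) * (2 * 𝔖.R * 𝔖.R)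
          * (kappaP 𝔖 P m * kappaP 𝔖 P m) := key
    _ ≤ 𝔖.lam⁻¹ * ((𝔖.a * 𝔖.growth (m + 2 * 𝔖.r) : ℕ) : ℝ) * (2 * 𝔖.R * 𝔖.R)
          * (kappaP 𝔖 P m * kappaP 𝔖 P m) := by gcongr
    _ = 𝔖.lam⁻¹ * ((𝔖.a * 𝔖.growth (m + 2 * 𝔖.r) : ℕ) : ℝ) * (2 * 𝔖.R ^ 2) * kappaP 𝔖 P m ^ 2 := by ring

end StepP

/-! ## §4 THE RELATIVE BARRIER: the quadratic recursion of `κ_P` along dyadic scales, modulo ONE relative seed -/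

section BarrierP

variable (𝔖 : Spec n) (P : ((Fin n → ℝ) → ℝ) → Prop)

/-- **THE RELATIVE BARRIER MODULO ONE RELATIVE SEED (PROVED).**  For a conditioning-closed `P`, along the dyadic scales
`s_{j+1} = 2 s_j + 3r + 1` with geometric shell growth `a·G(s_j + 2r) ≤ A q^j`, ONE smallness condition at ONE scale on the
RELATIVE profile, `c A q κ_P(s_0) ≤ ρ` (`c = 2R²∕λ`), yields `κ_P(s_j) ≤ ρ^{2^j} ∕ (c A q^{j+1})` at every scale — module VII's
`kappa_barrier` with `κ` replaced by `κ_P` (the relative step feeds `sq_barrier`).  The seed is a HYPOTHESIS.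
[cite: Martinelli1999, §2.4 p.103 (Def. 2.6, Thm 2.7); MartinelliOlivieri1994; HelfferSjostrand1994; Ledoux2001, Prop. 6.2 p.190] -/
theorem kappaP_barrier (hcl : CondClosed 𝔖 P) (s : ℕ → ℕ) (hs : ∀ j, s (j + 1) = 2 * s j + 3 * 𝔖.r + 1)
    {A q ρ : ℝ} (hA : 0 < A) (hq : 0 < q) (hN : ∀ j, ((𝔖.a * 𝔖.growth (s j + 2 * 𝔖.r) : ℕ) : ℝ) ≤ A * q ^ j)
    (hseed : 𝔖.cst * A * q * kappaP 𝔖 P (s 0) ≤ ρ) :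
    ∀ j, kappaP 𝔖 P (s j) ≤ ρ ^ 2 ^ j / (𝔖.cst * A * q ^ (j + 1)) := by
  have hc := 𝔖.cst_pos
  set b : ℕ → ℝ := fun j => 𝔖.cst * A * q ^ (j + 1) * kappaP 𝔖 P (s j) with hb
  have hb0 : ∀ j, 0 ≤ b j := fun j => by
    have := kappaP_nonneg 𝔖 P (s j); simp only [hb]; positivity
  have hbstep : ∀ j, b (j + 1) ≤ b j ^ 2 := by
    intro j
    have hM : 2 * s j + 3 * 𝔖.r < s (j + 1) := by rw [hs j]; exact Nat.lt_succ_self _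
    have h1 := kappaP_step 𝔖 P hcl hM
    have hκ := kappaP_nonneg 𝔖 P (s j)
    have h2 : kappaP 𝔖 P (s (j + 1)) ≤ 𝔖.cst * (A * q ^ j) * kappaP 𝔖 P (s j) ^ 2 := by
      refine h1.trans ?_
      unfold Spec.cst
      have hlam := 𝔖.lam_pos
      have := hN j
      calc 𝔖.lam⁻¹ * ((𝔖.a * 𝔖.growth (s j + 2 * 𝔖.r) : ℕ) : ℝ) * (2 * 𝔖.R ^ 2) * kappaP 𝔖 P (s j) ^ 2
          ≤ 𝔖.lam⁻¹ * (A * q ^ j) * (2 * 𝔖.R ^ 2) * kappaP 𝔖 P (s j) ^ 2 := by gcongr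
        _ = 𝔖.lam⁻¹ * (2 * 𝔖.R ^ 2) * (A * q ^ j) * kappaP 𝔖 P (s j) ^ 2 := by ring
    simp only [hb]
    calc 𝔖.cst * A * q ^ (j + 1 + 1) * kappaP 𝔖 P (s (j + 1))
        ≤ 𝔖.cst * A * q ^ (j + 1 + 1) * (𝔖.cst * (A * q ^ j) * kappaP 𝔖 P (s j) ^ 2) := by
          have : 0 ≤ 𝔖.cst * A * q ^ (j + 1 + 1) := by positivity
          exact mul_le_mul_of_nonneg_left h2 this
      _ = (𝔖.cst * A * q ^ (j + 1) * kappaP 𝔖 P (s j)) ^ 2 := by ring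
  have hseed' : b 0 ≤ ρ := by simpa [hb] using hseed
  intro j
  have h := sq_barrier hb0 hbstep hseed' j
  simp only [hb] at h
  have hpos : 0 < 𝔖.cst * A * q ^ (j + 1) := by positivity
  rw [le_div_iff₀ hpos]
  calc kappaP 𝔖 P (s j) * (𝔖.cst * A * q ^ (j + 1)) = 𝔖.cst * A * q ^ (j + 1) * kappaP 𝔖 P (s j) := by ring
    _ ≤ ρ ^ 2 ^ j := h

/-- Read-out between scales: `κ_P` is non-increasing, so `κ_P(m) ≤ ρ^{2^j} ∕ (c A q^{j+1})` for every `m ≥ s_j`.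
[cite: Martinelli1999, §2.4 p.103 (Def. 2.6, Thm 2.7); MartinelliOlivieri1994] -/
theorem kappaP_barrier_of_le (hcl : CondClosed 𝔖 P) (s : ℕ → ℕ) (hs : ∀ j, s (j + 1) = 2 * s j + 3 * 𝔖.r + 1)
    {A q ρ : ℝ} (hA : 0 < A) (hq : 0 < q) (hN : ∀ j, ((𝔖.a * 𝔖.growth (s j + 2 * 𝔖.r) : ℕ) : ℝ) ≤ A * q ^ j)
    (hseed : 𝔖.cst * A * q * kappaP 𝔖 P (s 0) ≤ ρ) {j m : ℕ} (hm : s j ≤ m) :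
    kappaP 𝔖 P m ≤ ρ ^ 2 ^ j / (𝔖.cst * A * q ^ (j + 1)) :=
  (kappaP_antitone 𝔖 P hm).trans (kappaP_barrier 𝔖 P hcl s hs hA hq hN hseed j)

/-- **The relative seed, spelled out**: a POINTWISE bound `|Cov_K(F,H)| ≤ ρ ∕ (c A q)` over the admissible triples at
separation `s₀` whose potential satisfies `P` is the seed `c A q κ_P(s₀) ≤ ρ`.  (For `P` = an in-situ class this is an
estimate for each member uniformly — NOT a class-wide statement over `𝔐`.)
[cite: Martinelli1999, §2.4 p.103 (Def. 2.6, Thm 2.7); MartinelliOlivieri1994] -/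
theorem kappaP_seed_of_forall {s₀ : ℕ} {A q ρ : ℝ} (hA : 0 < A) (hq : 0 < q) (hρ : 0 ≤ ρ)
    (h : ∀ f F H : (Fin n → ℝ) → ℝ, 𝔖.Adm s₀ f F H → P f → |cubeCov f 𝔖.S F H| ≤ ρ / (𝔖.cst * A * q)) :
    𝔖.cst * A * q * kappaP 𝔖 P s₀ ≤ ρ := by
  have hc := 𝔖.cst_pos
  have hpos : 0 < 𝔖.cst * A * q := by positivity
  have hk : kappaP 𝔖 P s₀ ≤ ρ / (𝔖.cst * A * q) :=
    kappaP_le_of_forall 𝔖 P (div_nonneg hρ hpos.le) h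
  calc 𝔖.cst * A * q * kappaP 𝔖 P s₀ ≤ 𝔖.cst * A * q * (ρ / (𝔖.cst * A * q)) :=
        mul_le_mul_of_nonneg_left hk hpos.le
    _ = ρ := mul_div_cancel₀ ρ hpos.ne'

end BarrierP

/-! ## §5 The in-situ read-out: ONE action, a seed uniform over a closed class containing it ∕ over its orbit -/

section InSitu

variable (𝔖 : Spec n)

/-- **IN-SITU DECAY FOR ONE ACTION FROM A RELATIVE SEED (PROVED).**  Let `P` be conditioning-closed with `P f₀`.  Along the
dyadic scales with geometric shell growth, ONE seed on the relative profile `c A q κ_P(s_0) ≤ ρ` bounds every admissible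
covariance OF `f₀` at separation `M ≥ s_j` by `ρ^{2^j} ∕ (c A q^{j+1})`.  Nothing is asked of the potentials outside `P`.
[cite: Martinelli1999, §2.4 p.103 (Def. 2.6, Thm 2.7); MartinelliOlivieri1994; BrascampLieb1976, Thm 4.1; FriedliVelenik2017, Lemma 6.7 (6.7)–(6.10)] -/
theorem abs_cubeCov_le_of_closed_seed {P : ((Fin n → ℝ) → ℝ) → Prop} (hcl : CondClosed 𝔖 P)
    {f₀ : (Fin n → ℝ) → ℝ} (h₀ : P f₀) (s : ℕ → ℕ) (hs : ∀ j, s (j + 1) = 2 * s j + 3 * 𝔖.r + 1)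
    {A q ρ : ℝ} (hA : 0 < A) (hq : 0 < q) (hN : ∀ j, ((𝔖.a * 𝔖.growth (s j + 2 * 𝔖.r) : ℕ) : ℝ) ≤ A * q ^ j)
    (hseed : 𝔖.cst * A * q * kappaP 𝔖 P (s 0) ≤ ρ) {j M : ℕ} (hM : s j ≤ M) {F H : (Fin n → ℝ) → ℝ}
    (hAdm : 𝔖.Adm M f₀ F H) : |cubeCov f₀ 𝔖.S F H| ≤ ρ ^ 2 ^ j / (𝔖.cst * A * q ^ (j + 1)) :=
  (abs_cubeCov_le_kappaP 𝔖 P hAdm h₀).trans (kappaP_barrier_of_le 𝔖 P hcl s hs hA hq hN hseed hM)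

/-- **… FROM A SEED OVER THE CONDITIONING ORBIT** — the least one can ask: the seed is a bound on the covariances of `f₀`
and of its iterated regularised conditional potentials (all wide labellings, all boundary fields in the window) at ONE
scale `s₀`.  This is the typed «in situ» form of the printed seed `sup_τ |μ_V^τ(f,g)|` of [Martinelli1999] Def. 2.6 ∕ Thm 2.7
for the windowed continuous-spin class.
[cite: Martinelli1999, §2.4 p.103 (Def. 2.6, Thm 2.7); MartinelliOlivieri1994; FriedliVelenik2017, Lemma 6.7 (6.7)–(6.10)] -/
theorem abs_cubeCov_le_of_orbit_seed (f₀ : (Fin n → ℝ) → ℝ) (s : ℕ → ℕ)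
    (hs : ∀ j, s (j + 1) = 2 * s j + 3 * 𝔖.r + 1) {A q ρ : ℝ} (hA : 0 < A) (hq : 0 < q)
    (hN : ∀ j, ((𝔖.a * 𝔖.growth (s j + 2 * 𝔖.r) : ℕ) : ℝ) ≤ A * q ^ j)
    (hseed : 𝔖.cst * A * q * kappaP 𝔖 (Orbit 𝔖 f₀) (s 0) ≤ ρ) {j M : ℕ} (hM : s j ≤ M) {F H : (Fin n → ℝ) → ℝ}
    (hAdm : 𝔖.Adm M f₀ F H) : |cubeCov f₀ 𝔖.S F H| ≤ ρ ^ 2 ^ j / (𝔖.cst * A * q ^ (j + 1)) :=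
  abs_cubeCov_le_of_closed_seed 𝔖 (condClosed_orbit 𝔖 f₀) (orbit_self 𝔖 f₀) s hs hA hq hN hseed hM hAdm

/-- The orbit seed follows from a seed on ANY closed class containing `f₀` (monotonicity of `κ_P` in `P`); so the consumer
may prove the pointwise bound of `kappaP_seed_of_forall` on a convenient closed over-class of the orbit.
[cite: Martinelli1999, §2.4 p.103 (Def. 2.6, Thm 2.7)] -/
theorem orbit_seed_of_closed_seed {P : ((Fin n → ℝ) → ℝ) → Prop} (hcl : CondClosed 𝔖 P) {f₀ : (Fin n → ℝ) → ℝ}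
    (h₀ : P f₀) {s₀ : ℕ} {A q ρ : ℝ} (hA : 0 < A) (hq : 0 < q)
    (hseed : 𝔖.cst * A * q * kappaP 𝔖 P s₀ ≤ ρ) : 𝔖.cst * A * q * kappaP 𝔖 (Orbit 𝔖 f₀) s₀ ≤ ρ := by
  have hc := 𝔖.cst_pos
  have hpos : 0 ≤ 𝔖.cst * A * q := by positivity
  exact (mul_le_mul_of_nonneg_left (kappaP_orbit_le 𝔖 hcl h₀ s₀) hpos).trans hseed

/-- Non-vacuity of the relative set-up at every level: the `λ`-Gaussian of module VII with the zero inserts is an admissible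
triple WITH `P` for `P = 𝔐` and for `P = Orbit q` (so neither relative profile is the bare adjoined `0` for a trivial
reason). [cite: BrascampLieb1976, Thm 4.1; Martinelli1999, §2.4 p.103 (Def. 2.6)] -/
theorem adm_gauss_zero_with (m : ℕ) :
    (𝔖.Adm m 𝔖.gauss (fun _ => 0) (fun _ => 0) ∧ 𝔖.InClass 𝔖.gauss) ∧
      (𝔖.Adm m 𝔖.gauss (fun _ => 0) (fun _ => 0) ∧ Orbit 𝔖 𝔖.gauss 𝔖.gauss) :=
  ⟨⟨𝔖.adm_gauss_zero m, 𝔖.inClass_gauss⟩, ⟨𝔖.adm_gauss_zero m, orbit_self 𝔖 𝔖.gauss⟩⟩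

end InSitu

/-! ## §6 A concrete conditioning-closed perturbative class: Hessian rows of oscillation `≤ ε` («near-Gaussian» potentials) -/

section NearGauss

variable (𝔖 : Spec n)

/-- HESSIAN-ROW OSCILLATION `≤ ε`: every row `∇∂_k f` of the Hessian varies by at most `ε` in `ℓ²` over the whole
space — `ε = 0` says the Hessian is constant (Gaussian potentials up to affine terms); for `f ∈ 𝔐` each row is
supported in the range ball `B_r(k)`, so the perturbation of the Hessian it allows has `n`-independent operator norms.
A typed candidate for an IN-SITU small-field class (the window caveat of module VII (iii) applies: the bound is global).
[folklore] [cite: BrascampLieb1976, Thm 4.1; Ledoux2001, Prop. 6.2 p.190] -/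
def RowOsc (ε : ℝ) (f : (Fin n → ℝ) → ℝ) : Prop :=
  ∀ k (y y' : Fin n → ℝ),
    (coordGradient (fun w => coordGradient f w k) y - coordGradient (fun w => coordGradient f w k) y')
        ⬝ᵥ (coordGradient (fun w => coordGradient f w k) y - coordGradient (fun w => coordGradient f w k) y')
      ≤ ε ^ 2

/-- THE NEAR-GAUSSIAN CLASS `𝔐_ε = 𝔐 ∩ {Hessian-row oscillation ≤ ε}`.
[folklore] [cite: BrascampLieb1976, Thm 4.1; Ledoux2001, Prop. 6.2 p.190; Martinelli1999, §2.4 p.103 (Def. 2.6)] -/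
def NearGauss (ε : ℝ) (f : (Fin n → ℝ) → ℝ) : Prop := 𝔖.InClass f ∧ RowOsc ε f

/-- A vector whose entries are entries of `w` or `0` is not longer than `w` (re-proved; module VII's copy is private). [folklore] [cite: HornJohnson2013, Thm 4.3.28 (4.3.30)] -/
private theorem dotProduct_self_le_of_eq_or_zero (v w : Fin n → ℝ) (h : ∀ i, v i = w i ∨ v i = 0) :
    v ⬝ᵥ v ≤ w ⬝ᵥ w :=
  Finset.sum_le_sum fun i _ => by
    rcases h i with h | h
    · rw [h]
    · rw [h, mul_zero]; exact mul_self_nonneg _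

/-- **Row oscillation passes to the regularised conditional potential (PROVED)**: along one-sided data, on an inside row
the Hessian row of `condPot lab λ f₁ x` at `z` is the `{lab ≠ 1}`-masked Hessian row of `f` at `merge lab x z`
(module IV `coordGradient_comp_merge_right` + the `inside` field of the data), on every other row it is the constant
`λ e_k`; masking does not increase `ℓ²` differences.
[cite: Spivak1965, Thm 2-2 (chain rule), Thm 2-3 (1)–(2); FriedliVelenik2017, Lemma 6.7 (6.7); FriedliVelenik2017, §6.10.1 (6.110)] -/
theorem rowOsc_condPot {lab : Fin n → Fin 3} {f f₁ f₂ : (Fin n → ℝ) → ℝ} {C : ℝ} (hD : 𝔖.SideData lab f f₁ f₂ C)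
    {ε : ℝ} (hε : RowOsc ε f) (x : Fin n → ℝ) : RowOsc ε (condPot lab 𝔖.lam f₁ x) := by
  obtain ⟨hfc, -, -, -⟩ := hD.inClass
  have hd₁ : Differentiable ℝ f₁ := hD.cd₁.differentiable (by norm_num)
  have hdk : ∀ k, Differentiable ℝ (fun y => coordGradient f y k) := fun k =>
    (contDiff_one_coordGradient hfc k).differentiable one_ne_zero
  intro k z z'
  by_cases hk : lab k = 0
  · have e0 : (fun w => coordGradient (condPot lab 𝔖.lam f₁ x) w k) = fun w => coordGradient f (merge lab x w) k := by
      funext w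
      rw [Spec.coordGradient_condPot_of_zero lab 𝔖.lam hd₁ hk x w, hD.inside k hk]
    have key : ∀ w, coordGradient (fun w' => coordGradient f (merge lab x w') k) w
        = fun i => if lab i ≠ 1 then coordGradient (fun y => coordGradient f y k) (merge lab x w) i else 0 :=
      fun w => funext fun i => coordGradient_comp_merge_right lab (hdk k) x w i
    rw [e0, key z, key z']
    refine le_trans (dotProduct_self_le_of_eq_or_zero _
      (coordGradient (fun y => coordGradient f y k) (merge lab x z)
        - coordGradient (fun y => coordGradient f y k) (merge lab x z')) fun i => ?_)
      (hε k (merge lab x z) (merge lab x z'))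
    simp only [Pi.sub_apply]
    split_ifs
    · exact Or.inl rfl
    · exact Or.inr (sub_self 0)
  · have e1 : (fun w => coordGradient (condPot lab 𝔖.lam f₁ x) w k) = fun w : Fin n → ℝ => 𝔖.lam * w k := by
      funext w
      exact Spec.coordGradient_condPot_of_ne_zero lab 𝔖.lam hd₁ hD.dep₁ hk x w
    have c : ∀ w : Fin n → ℝ, coordGradient (fun w' : Fin n → ℝ => 𝔖.lam * w' k) w
        = fun i => if i = k then 𝔖.lam else 0 :=
      fun w => funext fun i => coordGradient_const_mul_apply 𝔖.lam k w i
    rw [e1, c z, c z', sub_self, zero_dotProduct]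
    exact sq_nonneg ε

/-- **The near-Gaussian class `𝔐_ε` is conditioning-closed (PROVED)** — `𝔐` by module VII's `inClass_condPot`, the row
oscillation by `rowOsc_condPot`, both along `sideData_lo` (inside child) and `sideData_hi` (outside child, swapped
labelling). [cite: HornJohnson2013, Thm 4.3.28 (4.3.30); BrascampLieb1976, Thm 4.1; FriedliVelenik2017, Lemma 6.7 (6.7); FriedliVelenik2017, §6.10.1 (6.110)] -/
theorem condClosed_nearGauss (ε : ℝ) : CondClosed 𝔖 (NearGauss 𝔖 ε) := fun _ hw _ hf hN x _ =>
  ⟨⟨𝔖.inClass_condPot (𝔖.sideData_lo hf hw) x, rowOsc_condPot 𝔖 (𝔖.sideData_lo hf hw) hN.2 x⟩,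
    ⟨𝔖.inClass_condPot (𝔖.sideData_hi hf hw) x, rowOsc_condPot 𝔖 (𝔖.sideData_hi hf hw) hN.2 x⟩⟩

/-- The `λ`-Gaussian of module VII has constant Hessian rows: `RowOsc 0`. [cite: Spivak1965, Thm 2-3; BrascampLieb1976, Thm 4.1] -/
theorem rowOsc_gauss : RowOsc 0 𝔖.gauss := by
  intro k y y'
  have e : (fun w' => coordGradient 𝔖.gauss w' k) = fun w' : Fin n → ℝ => 𝔖.lam * w' k :=
    funext fun w' => 𝔖.coordGradient_gauss w' k
  have c : ∀ w : Fin n → ℝ, coordGradient (fun w' => coordGradient 𝔖.gauss w' k) w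
      = fun i => if i = k then 𝔖.lam else 0 := by
    intro w
    rw [e]
    exact funext fun i => coordGradient_const_mul_apply 𝔖.lam k w i
  rw [c y, c y', sub_self, zero_dotProduct]
  exact le_of_eq (by ring)

/-- **`𝔐_ε` is inhabited for every `ε`**: the `λ`-Gaussian is in `𝔐_0 ⊆ 𝔐_ε` (`0 ≤ ε^2`), and with the zero inserts it is an
admissible triple at every level (module VII `adm_gauss_zero`). [cite: BrascampLieb1976, Thm 4.1; Martinelli1999, §2.4 p.103 (Def. 2.6)] -/
theorem nearGauss_gauss (ε : ℝ) (m : ℕ) :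
    NearGauss 𝔖 ε 𝔖.gauss ∧ 𝔖.Adm m 𝔖.gauss (fun _ => 0) (fun _ => 0) := by
  refine ⟨⟨𝔖.inClass_gauss, fun k y y' => (rowOsc_gauss 𝔖 k y y').trans ?_⟩, 𝔖.adm_gauss_zero m⟩
  rw [zero_pow two_ne_zero]
  exact sq_nonneg ε

/-- **IN-SITU DECAY IN THE NEAR-GAUSSIAN CLASS (PROVED modulo the relative seed)**: for ONE action `f₀ ∈ 𝔐_ε`, a seed
`c A q κ_{𝔐_ε}(s_0) ≤ ρ` — an estimate over `𝔐_ε` only, uniform in the boundary field through the class — bounds every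
admissible covariance of `f₀` at separation `≥ s_j` by `ρ^{2^j} ∕ (c A q^{j+1})`.  The seed over `𝔐_ε` is NOT proved here.
[cite: Martinelli1999, §2.4 p.103 (Def. 2.6, Thm 2.7); MartinelliOlivieri1994; BrascampLieb1976, Thm 4.1; Ledoux2001, Prop. 6.2 p.190] -/
theorem abs_cubeCov_le_of_nearGauss_seed {ε : ℝ} {f₀ : (Fin n → ℝ) → ℝ} (h₀ : NearGauss 𝔖 ε f₀) (s : ℕ → ℕ)
    (hs : ∀ j, s (j + 1) = 2 * s j + 3 * 𝔖.r + 1) {A q ρ : ℝ} (hA : 0 < A) (hq : 0 < q)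
    (hN : ∀ j, ((𝔖.a * 𝔖.growth (s j + 2 * 𝔖.r) : ℕ) : ℝ) ≤ A * q ^ j)
    (hseed : 𝔖.cst * A * q * kappaP 𝔖 (NearGauss 𝔖 ε) (s 0) ≤ ρ) {j M : ℕ} (hM : s j ≤ M) {F H : (Fin n → ℝ) → ℝ}
    (hAdm : 𝔖.Adm M f₀ F H) : |cubeCov f₀ 𝔖.S F H| ≤ ρ ^ 2 ^ j / (𝔖.cst * A * q ^ (j + 1)) :=
  abs_cubeCov_le_of_closed_seed 𝔖 (condClosed_nearGauss 𝔖 ε) h₀ s hs hA hq hN hseed hM hAdm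

end NearGauss

end Literature.MathematicalPhysics.QuantumFieldTheory.Balaban1983to89.T4CubeShellProfileP
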